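import Summits.Ventures.HodgeRepro.Night3GSetWeilModel
import Summits.Ventures.HodgeRepro.Night1ProductWeilSpace

/-!
# The two overnight lines meet: night-3's concrete Weil space IS night-1's `weilSpaceProd`, and for a zero-sum family
it is a space of joint `(k, k)`-classes (typer-2's dictionary) — S4's object is a space of Hodge classes, on the kernel

Blind re-derivation cell `pub-hodge-repro`, seat `night-3` (gen 4).  Imports night-3's `Night3GSetWeilModel` (the
concrete model on `H M = ⋀^{|M|} ℂ^{Fin |M| × G}`, the lines `line n σ`, `weilSpace M`, the cast `castH`) and night-1's
`Night1ProductWeilSpace` (the Weil space `weilSpaceProd G k e = span {weilWedgeProd e σ}` of a corner family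
`e : Fin (2k) ≃ ι`, and `weilSpaceProd_le_jointEigenspaceOn`: for a `SumP k` family of CM types it lies in typer-2's joint
`λ^k`-eigenspace of the conjugate cocharacters of the product type — the `(k, k)`-classes).
Namespace `HodgeRepro.Night3.GSetModel`.

* `weilWedgeProd_refl` / **`weilSpaceProd_refl`** — with the identity enumeration of `Fin (2k)`, night-1's `σ`-line is
  night-3's `line (2k) σ` and night-1's Weil space is the span of night-3's lines (both by `rfl`);
* **`map_castH_weilSpace_familyMul`** — for the multiset `familyMul T = {T i : i}` of a corner family
  `T : Fin (2k) → Finset G`, night-3's concrete Weil space `weilSpace (familyMul T)` is carried by the cast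
  `|familyMul T| = 2k` onto night-1's `weilSpaceProd G k (Equiv.refl _)`: THE SAME SUBSPACE;
* `isZeroSumG_familyMul_iff_sumP` — night-3's zero-sum condition `IsZeroSumG c (familyMul T)` is night-1's / typer's
  `SumP k T` (every embedding in exactly `k` of the `2k` members) — gen 0's `isZeroSumG_familyMul_iff_sumTwo` at
  every level;
* **`weilSpace_familyMul_le_jointEigenspaceOn`** — for a zero-sum family of CM types, the concrete Weil space of
  night-3's model lies in the joint `(k, k)`-eigenspace of the product type for every Galois conjugate: the subspace
  whose algebraicity S4 asserts consists of HODGE classes (Pohlmann's criterion on the kernel: typer-2's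
  `jointEigenspaceOn_prod_eq_span`; Deligne LNM 900 §3 / Ex. 3.7).

Nothing here says anything about the status of the Hodge conjecture for CM abelian varieties, which is NOT proved.
-/

set_option autoImplicit false

open Finset Module
open scoped Pointwise

namespace HodgeRepro.Night3.GSetModel

open HodgeRepro.CMHodgeOn HodgeRepro.RouteC HodgeRepro.Night3.GSet HodgeRepro

variable {G : Type*} [Group G] [Fintype G] [DecidableEq G] [LinearOrder G]

omit [Group G] [Fintype G] [LinearOrder G] in
/-- Night-1's `σ`-line of the identity enumeration is night-3's `line`. -/
theorem weilWedgeProd_refl (k : ℕ) (σ : G) :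
    weilWedgeProd (Equiv.refl (Fin (2 * k))) σ = line (2 * k) σ := rfl

omit [Group G] [Fintype G] [LinearOrder G] in
/-- Night-1's Weil space of the identity enumeration is the span of night-3's lines. -/
theorem weilSpaceProd_refl (k : ℕ) :
    weilSpaceProd G k (Equiv.refl (Fin (2 * k))) = Submodule.span ℂ (Set.range (line (G := G) (2 * k))) := rfl

omit [Group G] [Fintype G] [DecidableEq G] [LinearOrder G] in
/-- A corner family of `2k` members has `2k` factors. -/
theorem card_familyMul {k : ℕ} (T : Fin (2 * k) → Finset G) : Multiset.card (familyMul T) = 2 * k := by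
  simp [familyMul]

omit [Group G] [Fintype G] [LinearOrder G] in
/-- **Night-3's concrete Weil space IS night-1's**: under the cast `|familyMul T| = 2k`, `weilSpace (familyMul T)` is
`weilSpaceProd G k (Equiv.refl _)`. -/
theorem map_castH_weilSpace_familyMul {k : ℕ} (T : Fin (2 * k) → Finset G) :
    (weilSpace (familyMul T)).map ((castH (G := G) (card_familyMul T)).toLinearMap) =
      weilSpaceProd G k (Equiv.refl (Fin (2 * k))) := by
  rw [weilSpaceProd_refl, weilSpace, Submodule.map_span, ← Set.range_comp]
  congr 2
  funext σ
  exact castH_line _ σ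

omit [Fintype G] [LinearOrder G] in
/-- Night-3's zero-sum condition on a corner family is typer's `SumP k` (gen 0's `isZeroSumG_familyMul_iff_sumTwo` at
every level `k`). -/
theorem isZeroSumG_familyMul_iff_sumP {c : G} {k : ℕ} {T : Fin (2 * k) → Finset G} (hT : ∀ i, IsCMType c (T i)) :
    IsZeroSumG c (familyMul T) ↔ SumP k T := by
  have hcard : Multiset.card (familyMul T) = 2 * k := card_familyMul T
  have hmem : IsCMMultiset c (familyMul T) := by
    intro S hS
    obtain ⟨i, -, rfl⟩ := Multiset.mem_map.1 hS
    exact hT i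
  simp only [IsZeroSumG, hmem, true_and, hcard, card_filter_familyMul, SumP]
  exact forall_congr' fun x => by omega

omit [LinearOrder G] in
/-- **S4's object is a space of Hodge classes**: for a zero-sum family `T` of CM types of `(G, c)`, the concrete Weil
space of night-3's model lies in typer-2's joint `(k, k)`-eigenspace of the conjugate cocharacters of the product type
(night-1's `weilSpaceProd_le_jointEigenspaceOn`). -/
theorem weilSpace_familyMul_le_jointEigenspaceOn {c : G} (hc : IsComplexConj c) {k : ℕ}
    {T : Fin (2 * k) → Finset G} (hT : ∀ i, IsCMType c (T i)) (hM : IsZeroSumG c (familyMul T)) :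
    (weilSpace (familyMul T)).map ((castH (G := G) (card_familyMul T)).toLinearMap) ≤
      jointEigenspaceOn (fun g : G => prodTypeSet fun i => g • T i) (2 * k) k := by
  rw [map_castH_weilSpace_familyMul]
  exact weilSpaceProd_le_jointEigenspaceOn hc hT ((isZeroSumG_familyMul_iff_sumP hT).mp hM) (Equiv.refl _)

end HodgeRepro.Night3.GSetModel
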